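import Summits.AtomisticToContinuum.HydrodynamicLimit.Theorems.InformationPercolationEngineChaosClosesEulerQuantitativeRigidity
import HarnessLib

/-!
# Dissipation rigidity — A: the Gaussian coarse-graining at fixed `δ`

Helper for the line `empirical-h-theorem` of the crux `InformationPercolationEngine.ChaosClosesEuler`
(stmt-AtomisticToContinuum-15141), registered stub `stub_dissipationRigidity`.

Elementary calculus of the objects of the dissipation functional at a FIXED coarse-graining `δ > 0`:

* the Gaussian kernel `φδ(v - w) = M_{1,δ²,w}(v)`: two-sided Gaussian bounds;
* the smoothed law `g(v) = ∫ φδ(v - w) dm(w)` of a finite measure `m`: `0 < g ≤ m(ℝ³) (2πδ²)^{-3/2}`,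
  continuity, and the Gaussian lower bound `g(v) ≥ μ₀ c e^{-R²/δ²} e^{-|v|²/δ²}` from mass `μ₀` in the
  ball of radius `R`; hence `|log g(v)| ≤ a + |v|²/δ²`;
* the floored logarithm `ℓ_K(v, y)` (logarithm above the floor `y₀(v) = e^{-K}(1+|v|²)^{-2}`, tangent
  line below): `log y ≤ ℓ_K(v, y) ≤ max (log y) (log y₀(v))`, so `|ℓ_K(v, y)| ≤ |log y|` for `K ≥ 0`;
  continuity of `v ↦ ℓ_K(v, g v)`;
* Gaussian convolutions `v ↦ ∫ φδ(v - u) F(u) du` of continuous `F` of quadratic growth: integrability,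
  the bound `a + b(|v|² + 3δ²)`, continuity (the tree's `continuousAt_integral_mul_localMaxwellian`).

References: C. Cercignani, R. Illner, M. Pulvirenti, *The Mathematical Theory of Dilute Gases* (1994), §3.2;
folklore.
-/

noncomputable section

namespace Summit.AtomisticToContinuum.HydrodynamicLimit.Theorems.ChaosClosesEulerDissipationRigidity

open scoped BigOperators Topology Classical MeasureTheory ENNReal InnerProductSpace
open Filter Set MeasureTheory
open Literature.MathematicalPhysics.KineticTheory
open Literature.Analysis.FluidPDE
open Summit.AtomisticToContinuum.HydrodynamicLimit.Theorems

/-! ## The Gaussian kernel -/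

/-- `φδ(v - w) = M_{1,δ²,w}(v)`. [folklore] -/
theorem phi_sub_eq (θ : ℝ) (v w : V3) :
    localMaxwellian 1 θ 0 (v - w) = localMaxwellian 1 θ w v := by
  simp only [localMaxwellian, sub_zero]

/-- `φδ(v - w) = M_{1,δ²,v}(w)` (the kernel is even). [folklore] -/
theorem phi_sub_eq' (θ : ℝ) (v w : V3) :
    localMaxwellian 1 θ 0 (v - w) = localMaxwellian 1 θ v w := by
  simp only [localMaxwellian, sub_zero, norm_sub_rev v w]

/-- The Gaussian upper bound `M_{1,θ,u}(v) ≤ (2πθ)^{-3/2}`. [folklore] -/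
theorem localMaxwellian_le_const {θ : ℝ} (hθ : 0 < θ) (u v : V3) :
    localMaxwellian 1 θ u v ≤ (2 * Real.pi * θ) ^ (-(Module.finrank ℝ V3 : ℝ) / 2) := by
  unfold localMaxwellian
  rw [one_mul]
  refine mul_le_of_le_one_right (Real.rpow_nonneg (by positivity) _) ?_
  rw [Real.exp_le_one_iff]
  exact div_nonpos_of_nonpos_of_nonneg (neg_nonpos.2 (sq_nonneg _)) (by positivity)

/-- The Gaussian lower bound: for `‖w‖ ≤ R`,
`M_{1,θ,w}(v) ≥ (2πθ)^{-3/2} e^{-2R²/(2θ)} e^{-2|v|²/(2θ)}`. [folklore] -/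
theorem localMaxwellian_ge_of_norm_le {θ : ℝ} (hθ : 0 < θ) {R : ℝ} {w : V3} (hw : ‖w‖ ≤ R) (v : V3) :
    (2 * Real.pi * θ) ^ (-(Module.finrank ℝ V3 : ℝ) / 2) * Real.exp (-(2 * R ^ 2) / (2 * θ)) *
        Real.exp (-(2 * ‖v‖ ^ 2) / (2 * θ)) ≤ localMaxwellian 1 θ w v := by
  unfold localMaxwellian
  rw [one_mul, mul_assoc, ← Real.exp_add]
  refine mul_le_mul_of_nonneg_left ?_ (Real.rpow_nonneg (by positivity) _)
  rw [Real.exp_le_exp]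
  have hR : 0 ≤ R := (norm_nonneg w).trans hw
  have h1 : ‖v - w‖ ≤ ‖v‖ + R := (norm_sub_le v w).trans (by linarith)
  have h2 : ‖v - w‖ ^ 2 ≤ 2 * ‖v‖ ^ 2 + 2 * R ^ 2 := by
    have h3 : ‖v - w‖ ^ 2 ≤ (‖v‖ + R) ^ 2 := pow_le_pow_left₀ (norm_nonneg _) h1 2
    nlinarith [sq_nonneg (‖v‖ - R)]
  rw [← add_div, div_le_div_iff_of_pos_right (by positivity)]
  linarith

/-! ## The smoothed law `g = m ∗ φδ` -/

/-- `w ↦ φδ(v - w)` is integrable under a finite measure. [folklore] -/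
theorem integrable_phi_sub {θ : ℝ} (hθ : 0 < θ) (m : Measure V3) [IsFiniteMeasure m] (v : V3) :
    Integrable (fun w => localMaxwellian 1 θ 0 (v - w)) m := by
  refine Integrable.of_bound ((continuous_localMaxwellian 1 θ 0).comp (continuous_const.sub
    continuous_id)).aestronglyMeasurable ((2 * Real.pi * θ) ^ (-(Module.finrank ℝ V3 : ℝ) / 2))
    (Eventually.of_forall fun w => ?_)
  rw [Real.norm_eq_abs, abs_of_nonneg (localMaxwellian_nonneg zero_le_one hθ.le _ _)]
  simpa only [phi_sub_eq] using localMaxwellian_le_const hθ w v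

/-- Upper bound `g(v) ≤ m(ℝ³) (2πθ)^{-3/2}`. [folklore] -/
theorem smoothedLaw_le {θ : ℝ} (hθ : 0 < θ) (m : Measure V3) [IsFiniteMeasure m] (v : V3) :
    ∫ w, localMaxwellian 1 θ 0 (v - w) ∂m ≤
      (m Set.univ).toReal * (2 * Real.pi * θ) ^ (-(Module.finrank ℝ V3 : ℝ) / 2) := by
  have h := integral_mono (integrable_phi_sub hθ m v) (integrable_const _)
    (fun w => show localMaxwellian 1 θ 0 (v - w) ≤ (2 * Real.pi * θ) ^ (-(Module.finrank ℝ V3 : ℝ) / 2)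
      by simpa only [phi_sub_eq] using localMaxwellian_le_const hθ w v)
  rwa [integral_const, smul_eq_mul, measureReal_def] at h

/-- `g ≥ 0`. [folklore] -/
theorem smoothedLaw_nonneg {θ : ℝ} (hθ : 0 ≤ θ) (m : Measure V3) (v : V3) :
    0 ≤ ∫ w, localMaxwellian 1 θ 0 (v - w) ∂m :=
  integral_nonneg fun _ => localMaxwellian_nonneg zero_le_one hθ _ _

/-- Gaussian lower bound for the smoothed law: if `m` puts mass `≥ μ₀` in the closed ball of radius `R`,
then `g(v) ≥ μ₀ (2πθ)^{-3/2} e^{-R²/θ} e^{-|v|²/θ}`. [folklore] -/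
theorem smoothedLaw_ge {θ : ℝ} (hθ : 0 < θ) (m : Measure V3) [IsFiniteMeasure m] {R μ₀ : ℝ}
    (hR : μ₀ ≤ (m (Metric.closedBall (0 : V3) R)).toReal) (v : V3) :
    μ₀ * ((2 * Real.pi * θ) ^ (-(Module.finrank ℝ V3 : ℝ) / 2) * Real.exp (-(2 * R ^ 2) / (2 * θ))) *
        Real.exp (-(2 * ‖v‖ ^ 2) / (2 * θ)) ≤ ∫ w, localMaxwellian 1 θ 0 (v - w) ∂m := by
  set c : ℝ := (2 * Real.pi * θ) ^ (-(Module.finrank ℝ V3 : ℝ) / 2) * Real.exp (-(2 * R ^ 2) / (2 * θ)) *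
    Real.exp (-(2 * ‖v‖ ^ 2) / (2 * θ)) with hc
  have hc0 : 0 ≤ c := by positivity
  have h1 : c * (m (Metric.closedBall (0 : V3) R)).toReal ≤
      ∫ w in Metric.closedBall (0 : V3) R, localMaxwellian 1 θ 0 (v - w) ∂m := by
    have h := setIntegral_ge_of_const_le_real (μ := m) (f := fun w => localMaxwellian 1 θ 0 (v - w))
      (s := Metric.closedBall (0 : V3) R) (c := c) measurableSet_closedBall (measure_ne_top _ _)
      (fun w hw => by
        rw [phi_sub_eq]
        exact localMaxwellian_ge_of_norm_le hθ (mem_closedBall_zero_iff.1 hw) v)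
      (integrable_phi_sub hθ m v).integrableOn
    simpa only [measureReal_def] using h
  have h2 : ∫ w in Metric.closedBall (0 : V3) R, localMaxwellian 1 θ 0 (v - w) ∂m ≤
      ∫ w, localMaxwellian 1 θ 0 (v - w) ∂m :=
    setIntegral_le_integral (integrable_phi_sub hθ m v)
      (Eventually.of_forall fun w => localMaxwellian_nonneg zero_le_one hθ.le _ _)
  calc μ₀ * ((2 * Real.pi * θ) ^ (-(Module.finrank ℝ V3 : ℝ) / 2) * Real.exp (-(2 * R ^ 2) / (2 * θ))) *
        Real.exp (-(2 * ‖v‖ ^ 2) / (2 * θ)) = μ₀ * c := by rw [hc]; ring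
    _ ≤ (m (Metric.closedBall (0 : V3) R)).toReal * c := mul_le_mul_of_nonneg_right hR hc0
    _ ≤ ∫ w, localMaxwellian 1 θ 0 (v - w) ∂m := by rw [mul_comm]; exact h1.trans h2

/-- The smoothed law of a finite measure is continuous (dominated convergence, constant majorant). [folklore] -/
theorem continuous_smoothedLaw {θ : ℝ} (hθ : 0 < θ) (m : Measure V3) [IsFiniteMeasure m] :
    Continuous fun v => ∫ w, localMaxwellian 1 θ 0 (v - w) ∂m := by
  refine continuous_of_dominated (bound := fun _ => (2 * Real.pi * θ) ^ (-(Module.finrank ℝ V3 : ℝ) / 2))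
    (fun v => (integrable_phi_sub hθ m v).aestronglyMeasurable) (fun v => Eventually.of_forall fun w => ?_)
    (integrable_const _) (Eventually.of_forall fun w => ?_)
  · rw [Real.norm_eq_abs, abs_of_nonneg (localMaxwellian_nonneg zero_le_one hθ.le _ _), phi_sub_eq]
    exact localMaxwellian_le_const hθ w v
  · exact (continuous_localMaxwellian 1 θ 0).comp (continuous_id.sub continuous_const)

/-- A finite measure of positive mass puts at least half of its mass... more precisely: for every
`μ₀ < m(ℝ³)` some closed ball has mass `≥ μ₀` (continuity from below). [folklore] -/
theorem exists_closedBall_measure_ge (m : Measure V3) [IsFiniteMeasure m] {μ₀ : ℝ}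
    (h : μ₀ < (m Set.univ).toReal) : ∃ R : ℝ, μ₀ ≤ (m (Metric.closedBall (0 : V3) R)).toReal := by
  have hmono : Monotone fun n : ℕ => Metric.closedBall (0 : V3) (n : ℝ) :=
    fun a b hab => Metric.closedBall_subset_closedBall (Nat.cast_le.2 hab)
  have hU : (⋃ n : ℕ, Metric.closedBall (0 : V3) (n : ℝ)) = Set.univ := by
    ext v
    simp only [mem_iUnion, Metric.mem_closedBall, dist_zero_right, mem_univ, iff_true]
    exact ⟨⌈‖v‖⌉₊, Nat.le_ceil _⟩
  have ht := tendsto_measure_iUnion_atTop (μ := m) hmono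
  rw [hU] at ht
  have ht' : Tendsto (fun n : ℕ => (m (Metric.closedBall (0 : V3) (n : ℝ))).toReal) atTop
      (𝓝 (m Set.univ).toReal) := (ENNReal.tendsto_toReal (measure_ne_top _ _)).comp ht
  obtain ⟨n, hn⟩ := ((tendsto_order.1 ht').1 μ₀ h).exists
  exact ⟨n, hn.le⟩

/-- **Two-sided logarithmic bound.** If `0 < c₁ e^{-|v|²/θ} ≤ x ≤ C₂` then
`|log x| ≤ |log c₁| + |log C₂| + |v|²/θ`. [folklore] -/
theorem abs_log_le_of_bounds {θ c₁ C₂ x : ℝ} (hθ : 0 < θ) (hc₁ : 0 < c₁) {v : V3}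
    (hlo : c₁ * Real.exp (-(2 * ‖v‖ ^ 2) / (2 * θ)) ≤ x) (hhi : x ≤ C₂) :
    |Real.log x| ≤ |Real.log c₁| + |Real.log C₂| + ‖v‖ ^ 2 / θ := by
  have hx : 0 < x := lt_of_lt_of_le (mul_pos hc₁ (Real.exp_pos _)) hlo
  have h1 : Real.log c₁ + -(2 * ‖v‖ ^ 2) / (2 * θ) ≤ Real.log x := by
    have := Real.log_le_log (mul_pos hc₁ (Real.exp_pos _)) hlo
    rwa [Real.log_mul hc₁.ne' (Real.exp_pos _).ne', Real.log_exp] at this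
  have h2 : Real.log x ≤ Real.log C₂ := Real.log_le_log hx hhi
  have h3 : -(2 * ‖v‖ ^ 2) / (2 * θ) = -(‖v‖ ^ 2 / θ) := by
    field_simp
  rw [h3] at h1
  have ht : 0 ≤ ‖v‖ ^ 2 / θ := div_nonneg (sq_nonneg _) hθ.le
  rw [abs_le]
  constructor
  · linarith [neg_abs_le (Real.log c₁), abs_nonneg (Real.log C₂)]
  · linarith [le_abs_self (Real.log C₂), abs_nonneg (Real.log c₁)]

/-! ## The floored logarithm -/

/-- The floor `y₀(v) = e^{-K} (1 + |v|²)^{-2}` is positive. [folklore] -/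
theorem floor_pos (K : ℝ) (v : V3) : 0 < Real.exp (-K) * ((1 + ‖v‖ ^ 2) ^ 2)⁻¹ := by positivity

/-- For `K ≥ 0` the floor is `≤ 1`. [folklore] -/
theorem floor_le_one {K : ℝ} (hK : 0 ≤ K) (v : V3) : Real.exp (-K) * ((1 + ‖v‖ ^ 2) ^ 2)⁻¹ ≤ 1 := by
  have h1 : Real.exp (-K) ≤ 1 := Real.exp_le_one_iff.2 (neg_nonpos.2 hK)
  have h2 : ((1 + ‖v‖ ^ 2) ^ 2)⁻¹ ≤ 1 := inv_le_one_of_one_le₀ (by nlinarith [sq_nonneg ‖v‖])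
  exact mul_le_one₀ h1 (by positivity) h2

/-- **Tangent line above the logarithm**: `log y ≤ ℓ_K(v, y)` for `y > 0` (concavity of `log`:
`log (y/y₀) ≤ y/y₀ - 1`). [folklore] -/
theorem log_le_flooredLog {y₀ y : ℝ} (hy₀ : 0 < y₀) (hy : 0 < y) :
    Real.log y ≤ (if y₀ ≤ y then Real.log y else Real.log y₀ + (y - y₀) / y₀) := by
  split_ifs with h
  · exact le_rfl
  · have h1 : Real.log (y / y₀) ≤ y / y₀ - 1 := Real.log_le_sub_one_of_pos (div_pos hy hy₀)
    rw [Real.log_div hy.ne' hy₀.ne'] at h1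
    have h2 : (y - y₀) / y₀ = y / y₀ - 1 := by field_simp
    rw [h2]
    linarith

/-- `ℓ_K(v, y) ≤ max (log y) (log y₀(v))` for `y > 0`. [folklore] -/
theorem flooredLog_le_max {y₀ y : ℝ} (hy₀ : 0 < y₀) :
    (if y₀ ≤ y then Real.log y else Real.log y₀ + (y - y₀) / y₀) ≤ max (Real.log y) (Real.log y₀) := by
  split_ifs with h
  · exact le_max_left _ _
  · refine le_trans ?_ (le_max_right _ _)
    have : (y - y₀) / y₀ ≤ 0 := div_nonpos_of_nonpos_of_nonneg (by linarith [lt_of_not_ge h]) hy₀.le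
    linarith

/-- **`K`-independent domination of the floored logarithm**: if the floor is `≤ 1` then
`|ℓ_K(v, y)| ≤ |log y|` for every `y > 0`. [folklore] -/
theorem abs_flooredLog_le {y₀ y : ℝ} (hy₀ : 0 < y₀) (hy₀1 : y₀ ≤ 1) (hy : 0 < y) :
    |(if y₀ ≤ y then Real.log y else Real.log y₀ + (y - y₀) / y₀)| ≤ |Real.log y| := by
  have hlo := log_le_flooredLog (y := y) hy₀ hy
  have hhi := flooredLog_le_max (y := y) hy₀
  have hl0 : Real.log y₀ ≤ 0 := Real.log_nonpos hy₀.le hy₀1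
  rw [abs_le]
  constructor
  · linarith [neg_abs_le (Real.log y)]
  · refine hhi.trans (max_le (le_abs_self _) (hl0.trans (abs_nonneg _)))

/-- The floored logarithm of a continuous positive function is continuous (the two branches agree on
the switching set `y₀(v) = g(v)`). [folklore] -/
theorem continuous_flooredLog_comp (K : ℝ) {g : V3 → ℝ} (hg : Continuous g) (hpos : ∀ v, 0 < g v) :
    Continuous fun v => (if Real.exp (-K) * ((1 + ‖v‖ ^ 2) ^ 2)⁻¹ ≤ g v then Real.log (g v)
      else Real.log (Real.exp (-K) * ((1 + ‖v‖ ^ 2) ^ 2)⁻¹) +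
        (g v - Real.exp (-K) * ((1 + ‖v‖ ^ 2) ^ 2)⁻¹) / (Real.exp (-K) * ((1 + ‖v‖ ^ 2) ^ 2)⁻¹)) := by
  have hy : Continuous fun v : V3 => Real.exp (-K) * ((1 + ‖v‖ ^ 2) ^ 2)⁻¹ := by
    refine continuous_const.mul (Continuous.inv₀ ?_ fun v => by positivity)
    fun_prop
  refine Continuous.if_le (hg.log fun v => (hpos v).ne') ?_ hy hg (fun v hv => ?_)
  · exact (hy.log fun v => (floor_pos K v).ne').add ((hg.sub hy).div hy fun v => (floor_pos K v).ne')
  · rw [hv, sub_self, zero_div, add_zero]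

/-! ## Gaussian convolutions of functions of quadratic growth -/

/-- A function of quadratic growth is dominated by `(|a| + |b|)(1 + |u|²)²`. [folklore] -/
theorem quad_le_sq {a b : ℝ} {F : V3 → ℝ} (hF : ∀ u, |F u| ≤ a + b * ‖u‖ ^ 2) (u : V3) :
    |F u| ≤ (|a| + |b|) * (1 + ‖u‖ ^ 2) ^ 2 := by
  refine (hF u).trans ?_
  have h1 : a ≤ |a| * (1 + ‖u‖ ^ 2) ^ 2 :=
    (le_abs_self a).trans (le_mul_of_one_le_right (abs_nonneg a) (by nlinarith [sq_nonneg ‖u‖]))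
  have h2 : b * ‖u‖ ^ 2 ≤ |b| * (1 + ‖u‖ ^ 2) ^ 2 := by
    have : ‖u‖ ^ 2 ≤ (1 + ‖u‖ ^ 2) ^ 2 := by nlinarith [sq_nonneg ‖u‖]
    calc b * ‖u‖ ^ 2 ≤ |b| * ‖u‖ ^ 2 := mul_le_mul_of_nonneg_right (le_abs_self b) (sq_nonneg _)
      _ ≤ |b| * (1 + ‖u‖ ^ 2) ^ 2 := mul_le_mul_of_nonneg_left this (abs_nonneg b)
  linarith

/-- **Integrability** of `u ↦ φδ(v - u) F(u)` for a measurable `F` of quadratic growth. [folklore] -/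
theorem integrable_phi_mul {θ : ℝ} (hθ : 0 < θ) {F : V3 → ℝ} (hFm : AEStronglyMeasurable F volume)
    {a b : ℝ} (hF : ∀ u, |F u| ≤ a + b * ‖u‖ ^ 2) (v : V3) :
    Integrable (fun u => localMaxwellian 1 θ 0 (v - u) * F u) := by
  have h := integrable_localMaxwellian_mul_of_abs_le hθ v hFm (quad_le_sq hF)
  refine h.congr (Eventually.of_forall fun u => ?_)
  simp only [phi_sub_eq']

/-- **The convolved quadratic bound**: `|∫ φδ(v - u) F(u) du| ≤ a + b (|v|² + 3θ)` when
`|F(u)| ≤ a + b|u|²`. [folklore] -/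
theorem abs_conv_phi_le {θ : ℝ} (hθ : 0 < θ) {F : V3 → ℝ} (hFm : AEStronglyMeasurable F volume)
    {a b : ℝ} (hF : ∀ u, |F u| ≤ a + b * ‖u‖ ^ 2) (v : V3) :
    |∫ u, localMaxwellian 1 θ 0 (v - u) * F u| ≤ a + b * (‖v‖ ^ 2 + 3 * θ) := by
  have hint := integrable_phi_mul hθ hFm hF v
  have hquad : Integrable (fun u : V3 => localMaxwellian 1 θ v u * (a + ⟪(0 : V3), u⟫_ℝ + (2 * b) * ‖u‖ ^ 2 / 2)) := by
    have hc : Continuous fun u : V3 => a + ⟪(0 : V3), u⟫_ℝ + (2 * b) * ‖u‖ ^ 2 / 2 := by fun_prop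
    refine integrable_localMaxwellian_mul_of_abs_le hθ v hc.aestronglyMeasurable (K := |a| + |b|) fun u => ?_
    have hq := quad_le_sq (F := fun u : V3 => a + b * ‖u‖ ^ 2) (a := |a|) (b := |b|) (fun u => ?_) u
    · rw [abs_abs, abs_abs] at hq
      have : a + ⟪(0 : V3), u⟫_ℝ + 2 * b * ‖u‖ ^ 2 / 2 = a + b * ‖u‖ ^ 2 := by rw [inner_zero_left]; ring
      rw [this]
      exact hq
    · calc |a + b * ‖u‖ ^ 2| ≤ |a| + |b * ‖u‖ ^ 2| := abs_add_le _ _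
        _ = |a| + |b| * ‖u‖ ^ 2 := by rw [abs_mul, abs_of_nonneg (sq_nonneg ‖u‖)]
  have hval : ∫ u, localMaxwellian 1 θ v u * (a + ⟪(0 : V3), u⟫_ℝ + (2 * b) * ‖u‖ ^ 2 / 2) =
      a + b * (‖v‖ ^ 2 + 3 * θ) := by
    rw [integral_localMaxwellian_mul_affine hθ v a (2 * b) 0, inner_zero_left]
    ring
  calc |∫ u, localMaxwellian 1 θ 0 (v - u) * F u| ≤ ∫ u, |localMaxwellian 1 θ 0 (v - u) * F u| :=
        abs_integral_le_integral_abs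
    _ ≤ ∫ u, localMaxwellian 1 θ v u * (a + ⟪(0 : V3), u⟫_ℝ + (2 * b) * ‖u‖ ^ 2 / 2) := by
        refine integral_mono hint.abs hquad fun u => ?_
        dsimp only
        rw [abs_mul, abs_of_nonneg (localMaxwellian_nonneg zero_le_one hθ.le _ _), phi_sub_eq',
          inner_zero_left, add_zero]
        refine mul_le_mul_of_nonneg_left ?_ (localMaxwellian_nonneg zero_le_one hθ.le _ _)
        have : a + 2 * b * ‖u‖ ^ 2 / 2 = a + b * ‖u‖ ^ 2 := by ring
        rw [this]
        exact hF u
    _ = a + b * (‖v‖ ^ 2 + 3 * θ) := hval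

/-- **Continuity of Gaussian convolutions** of a continuous `F` of quadratic growth:
`v ↦ ∫ φδ(v - u) F(u) du` is continuous (`continuousAt_integral_mul_localMaxwellian`). [folklore] -/
theorem continuous_conv_phi {θ : ℝ} (hθ : 0 < θ) {F : V3 → ℝ} (hFc : Continuous F)
    {a b : ℝ} (hF : ∀ u, |F u| ≤ a + b * ‖u‖ ^ 2) :
    Continuous fun v => ∫ u, localMaxwellian 1 θ 0 (v - u) * F u := by
  have hfun : (fun v => ∫ u, localMaxwellian 1 θ 0 (v - u) * F u) =
      (fun p : V3 × ℝ => ∫ u, (fun q : V3 × V3 × ℝ => F q.1) (u, p.1, p.2) * localMaxwellian 1 p.2 p.1 u) ∘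
        fun v => (v, θ) := by
    funext v
    simp only [Function.comp_apply]
    refine integral_congr_ae (Eventually.of_forall fun u => ?_)
    simp only [phi_sub_eq', mul_comm]
  rw [hfun]
  refine continuous_iff_continuousAt.2 fun v => ?_
  refine ContinuousAt.comp ?_ (continuous_id.prodMk continuous_const).continuousAt
  refine EvenStressEnskog.continuousAt_integral_mul_localMaxwellian (F := fun q : V3 × V3 × ℝ => F q.1)
    (hFc.comp continuous_fst) ⟨|a| + |b|, fun q => ?_⟩ v hθ
  refine (hF q.1).trans ?_
  have h1 : a ≤ |a| * (1 + ‖q.1‖ ^ 2 + ‖q.2.1‖ ^ 2 + |q.2.2|) :=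
    (le_abs_self a).trans (le_mul_of_one_le_right (abs_nonneg a)
      (by nlinarith [sq_nonneg ‖q.1‖, sq_nonneg ‖q.2.1‖, abs_nonneg q.2.2]))
  have h2 : b * ‖q.1‖ ^ 2 ≤ |b| * (1 + ‖q.1‖ ^ 2 + ‖q.2.1‖ ^ 2 + |q.2.2|) := by
    calc b * ‖q.1‖ ^ 2 ≤ |b| * ‖q.1‖ ^ 2 := mul_le_mul_of_nonneg_right (le_abs_self b) (sq_nonneg _)
      _ ≤ |b| * (1 + ‖q.1‖ ^ 2 + ‖q.2.1‖ ^ 2 + |q.2.2|) :=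
        mul_le_mul_of_nonneg_left (by nlinarith [sq_nonneg ‖q.2.1‖, abs_nonneg q.2.2]) (abs_nonneg b)
  linarith

/-! ## Registered sub-goal -/

/-- **Registered sub-goal `stub_dissipationRigidityA` (helper A of `stub_dissipationRigidity`): the
`K`-independent domination of the floored logarithm, `|ℓ_K(v, y)| ≤ |log y|` once the floor is `≤ 1`.**
[folklore] -/
theorem stub_dissipationRigidityA : ∀ {y₀ y : ℝ}, 0 < y₀ → y₀ ≤ 1 → 0 < y → |(if y₀ ≤ y then Real.log y else Real.log y₀ + (y - y₀) / y₀)| ≤ |Real.log y| :=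
  fun hy₀ hy₀1 hy => abs_flooredLog_le hy₀ hy₀1 hy

end Summit.AtomisticToContinuum.HydrodynamicLimit.Theorems.ChaosClosesEulerDissipationRigidity

end
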